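import Summits.NavierStokesRegularity.NavierStokesRegularity.Theorems.LerayQuarterDissipationFiniteDissipationLiouvilleHullCategoryPortrait
import Summits.NavierStokesRegularity.NavierStokesRegularity.Theorems.LerayQuarterDissipationFiniteDissipationLiouvilleHullCategoryMinimal
import HarnessLib

/-!
# Crux `FiniteDissipationLiouville` (stmt-NavierStokesRegularity-22144), line `birth`:
# CATEGORY ON THE SCALING HULL — the hull of a wandering critical element consists of critical
# elements and is not covered by countably many scaling orbits

Helper file (theorems only, `--supports` the crux), assembling `…HullCategory` (Baire on the
compact scaling hull), `…HullCategoryMinimal` (minimality: scaling limits of a uniformly recurrent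
member are uniformly recurrent) and the persistence of the apex singularity
(`RecurrentReductionD.persistent_singularity`):

* `exists_criticalElement_off_orbits` — the (v23) CATEGORY clause of the line's skeleton: a
  critical element `u ∈ 𝒟_{C,K}` (SINGULAR at the origin and UNIFORMLY RECURRENT under the scaling
  flow) which is not past-DSS has, for EVERY sequence of fields `V i` continuous on the open past,
  a scaling limit `W ∈ 𝒟_{C,K}` which is again a CRITICAL ELEMENT (singular, uniformly recurrent
  with the item's window clause) and agrees on the past with no rescaling of any `V i`. So the
  wandering stratum of the crux — its residue beyond the catalogued wall
  `∀ c>1, TypeIDSSLiouville c` — is either empty or contains uncountably many critical elements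
  modulo scaling, all inside one compact minimal hull.
* `exists_criticalElement_off_orbits_of_wall` — under the wall the past-DSS alternative is absent
  (`…Birth.pastDssExclusion_of_typeIDSSLiouville`), so this holds for every critical element.

No summit is proved by this file; Navier–Stokes regularity is NOT proved by anything here; the
crux stays FRONTIER (blocked on `∀ c>1, TypeIDSSLiouville c`, NECESSARY by `…Hardness`).

References: H. Furstenberg (1981), Ch. 1 §4, Thms. 1.15–1.17 [Furstenberg1981]; G. Koch,
N. Nadirashvili, G. Seregin, V. Šverák, Acta Math. 203 (2009), §4 [KochNadirashviliSereginSverak2009];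
Z. Bradshaw, T.-P. Tsai, Comm. PDE 42 (2017), §5 OP 5.1 [BradshawTsai2017CPDE].
-/

noncomputable section

-- the summit and its single problem share the name (D-0017 nested layout)
set_option linter.dupNamespace false

namespace Summit.NavierStokesRegularity.NavierStokesRegularity.Theorems.FiniteDissipationLiouville.HullCategory

open scoped Topology
open MeasureTheory Set Function Filter Metric TopologicalSpace Topology
open Literature.Analysis.FluidPDE
open Summit.NavierStokesRegularity.NavierStokesRegularity.Theorems.RecurrentReductionD

/-- **The hull of a wandering critical element consists of critical elements and is not covered by
countably many scaling orbits.** For `u ∈ 𝒟_{C,K}` singular at the origin, uniformly recurrent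
under the scaling flow and not past-DSS, and any sequence of fields `V i` continuous on the open
past: some scaling limit `W ∈ 𝒟_{C,K}` of `u` (pointwise on the open past along rescalings
`u_{l_k}`, `l_k > 0`) is SINGULAR at the origin, UNIFORMLY RECURRENT with the item's window
clause, and differs on the past from every rescaling of every `V i`
(`exists_orbitLimit_off_orbits` + `persistent_singularity` + `recurrent_of_orbitLimit`).
[cite: Furstenberg1981, Ch. 1 §4, Thms. 1.15–1.17] -/
theorem exists_criticalElement_off_orbits {C K : ℝ}
    {u : ℝ → EuclideanSpace ℝ (Fin 3) → EuclideanSpace ℝ (Fin 3)}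
    (hu : IsTypeIAncientMild C u)
    (hlaw : ∀ s : ℝ, s < 0 → ∫⁻ x, ‖fderiv ℝ (u s) x‖ₑ ^ 2 ≤ ENNReal.ofReal (K / Real.sqrt (-s)))
    (hsing : ∀ r > 0, ∀ M : ℝ, ∃ t ∈ Ioo (-(r ^ 2)) (0 : ℝ),
      ∃ x ∈ ball (0 : EuclideanSpace ℝ (Fin 3)) r, M < ‖u t x‖)
    (hrec : ∀ ε > 0, ∀ R > 1, ∃ L > 0, ∀ a : ℝ, ∃ σ ∈ Icc a (a + L),
      ∀ s ∈ Icc (-(R ^ 2)) (-(R⁻¹) ^ 2), ∀ y ∈ closedBall (0 : EuclideanSpace ℝ (Fin 3)) R,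
        ‖Real.exp σ • u (Real.exp (2 * σ) * s) (Real.exp σ • y) - u s y‖ ≤ ε)
    (hndss : ∀ c : ℝ, 1 < c → ¬ ∀ t : ℝ, t < 0 → ∀ x, c • u (c ^ 2 * t) (c • x) = u t x)
    (V : ℕ → ℝ → EuclideanSpace ℝ (Fin 3) → EuclideanSpace ℝ (Fin 3))
    (hV : ∀ i, ContinuousOn (uncurry (V i)) (Iio 0 ×ˢ univ)) :
    ∃ W : ℝ → EuclideanSpace ℝ (Fin 3) → EuclideanSpace ℝ (Fin 3),
      IsTypeIAncientMild C W ∧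
      (∀ s : ℝ, s < 0 → ∫⁻ x, ‖fderiv ℝ (W s) x‖ₑ ^ 2 ≤ ENNReal.ofReal (K / Real.sqrt (-s))) ∧
      (∀ r > 0, ∀ M : ℝ, ∃ t ∈ Ioo (-(r ^ 2)) (0 : ℝ),
        ∃ x ∈ ball (0 : EuclideanSpace ℝ (Fin 3)) r, M < ‖W t x‖) ∧
      (∀ ε > 0, ∀ R > 1, ∃ L > 0, ∀ a : ℝ, ∃ σ ∈ Icc a (a + L),
        ∀ s ∈ Icc (-(R ^ 2)) (-(R⁻¹) ^ 2), ∀ y ∈ closedBall (0 : EuclideanSpace ℝ (Fin 3)) R,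
          ‖Real.exp σ • W (Real.exp (2 * σ) * s) (Real.exp σ • y) - W s y‖ ≤ ε) ∧
      (∃ l : ℕ → ℝ, (∀ k, 0 < l k) ∧
        ∀ t < 0, ∀ x, Tendsto (fun k => nsRescale (l k) u t x) atTop (𝓝 (W t x))) ∧
      ∀ i : ℕ, ∀ c : ℝ, 0 < c → ∃ t : ℝ, t < 0 ∧ ∃ x, W t x ≠ nsRescale c (V i) t x := by
  obtain ⟨l, hl, W, hW, hlawW, hWu, hpt, hoff⟩ := exists_orbitLimit_off_orbits hu hlaw hrec hndss V hV
  exact ⟨W, hW, hlawW, persistent_singularity hu hlaw hsing l hl W hWu,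
    recurrent_of_orbitLimit hu hlaw hrec l hl hW hlawW hWu, ⟨l, hl, hpt⟩, hoff⟩

/-- **Under the catalogued wall** (`TypeIDSSLiouville c` for every `c > 1`, Bradshaw–Tsai 2017
OP 5.1, NECESSARY for the crux) every critical element of `𝒟_{C,K}` is wandering, so the
conclusion of `exists_criticalElement_off_orbits` holds for it unconditionally: its scaling hull
contains, off any countable family of scaling orbits, further critical elements.
[cite: BradshawTsai2017CPDE, §5 Open Problem 5.1] -/
theorem exists_criticalElement_off_orbits_of_wall
    (hwall : ∀ c : ℝ, 1 < c → TypeIDSSLiouville c) {C K : ℝ}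
    {u : ℝ → EuclideanSpace ℝ (Fin 3) → EuclideanSpace ℝ (Fin 3)}
    (hu : IsTypeIAncientMild C u)
    (hlaw : ∀ s : ℝ, s < 0 → ∫⁻ x, ‖fderiv ℝ (u s) x‖ₑ ^ 2 ≤ ENNReal.ofReal (K / Real.sqrt (-s)))
    (hsing : ∀ r > 0, ∀ M : ℝ, ∃ t ∈ Ioo (-(r ^ 2)) (0 : ℝ),
      ∃ x ∈ ball (0 : EuclideanSpace ℝ (Fin 3)) r, M < ‖u t x‖)
    (hrec : ∀ ε > 0, ∀ R > 1, ∃ L > 0, ∀ a : ℝ, ∃ σ ∈ Icc a (a + L),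
      ∀ s ∈ Icc (-(R ^ 2)) (-(R⁻¹) ^ 2), ∀ y ∈ closedBall (0 : EuclideanSpace ℝ (Fin 3)) R,
        ‖Real.exp σ • u (Real.exp (2 * σ) * s) (Real.exp σ • y) - u s y‖ ≤ ε)
    (V : ℕ → ℝ → EuclideanSpace ℝ (Fin 3) → EuclideanSpace ℝ (Fin 3))
    (hV : ∀ i, ContinuousOn (uncurry (V i)) (Iio 0 ×ˢ univ)) :
    ∃ W : ℝ → EuclideanSpace ℝ (Fin 3) → EuclideanSpace ℝ (Fin 3),
      IsTypeIAncientMild C W ∧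
      (∀ s : ℝ, s < 0 → ∫⁻ x, ‖fderiv ℝ (W s) x‖ₑ ^ 2 ≤ ENNReal.ofReal (K / Real.sqrt (-s))) ∧
      (∀ r > 0, ∀ M : ℝ, ∃ t ∈ Ioo (-(r ^ 2)) (0 : ℝ),
        ∃ x ∈ ball (0 : EuclideanSpace ℝ (Fin 3)) r, M < ‖W t x‖) ∧
      (∀ ε > 0, ∀ R > 1, ∃ L > 0, ∀ a : ℝ, ∃ σ ∈ Icc a (a + L),
        ∀ s ∈ Icc (-(R ^ 2)) (-(R⁻¹) ^ 2), ∀ y ∈ closedBall (0 : EuclideanSpace ℝ (Fin 3)) R,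
          ‖Real.exp σ • W (Real.exp (2 * σ) * s) (Real.exp σ • y) - W s y‖ ≤ ε) ∧
      (∃ l : ℕ → ℝ, (∀ k, 0 < l k) ∧
        ∀ t < 0, ∀ x, Tendsto (fun k => nsRescale (l k) u t x) atTop (𝓝 (W t x))) ∧
      ∀ i : ℕ, ∀ c : ℝ, 0 < c → ∃ t : ℝ, t < 0 ∧ ∃ x, W t x ≠ nsRescale c (V i) t x :=
  exists_criticalElement_off_orbits hu hlaw hsing hrec
    (fun c hc hdss =>
      FiniteDissipationLiouville.Birth.pastDssExclusion_of_typeIDSSLiouville hwall C K c u hc hu hlaw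
        hdss hsing) V hV

end Summit.NavierStokesRegularity.NavierStokesRegularity.Theorems.FiniteDissipationLiouville.HullCategory

end
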